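import Summits.AtomisticToContinuum.BoseEinsteinCondensation.Theorems.BECCutLineWeakDisorderGroundStateRigidityStubClosedJensen
import Summits.AtomisticToContinuum.BoseEinsteinCondensation.Theorems.BECCutLineWeakDisorderGroundStateRigidityStubStabilityOfJensen
import Summits.AtomisticToContinuum.BoseEinsteinCondensation.Theorems.BECCutLineWeakDisorderGroundStateRigidityEssBounded
import HarnessLib

/-!
# Crux `GroundStateRigidity` (stmt-AtomisticToContinuum-9072), line `Sketch`: stub `stub_posOfTrunc`

Supports (does not close) stmt-AtomisticToContinuum-9072; stub `stub_posOfTrunc` of line `Sketch`,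
skeleton v4 (lead c2). **A.e. positivity of nonnegative closed-form ground states for pair potentials
locally bounded on `(0, ∞)`, from energy truncation.** Given the statements of the neighbouring stubs
`stub_closedJensen` and `stub_localTube` as hypotheses, `N ≥ 1`, `L > 0`, `v` measurable and bounded
on every `[r, ∞)`, `r > 0`, with `supₙ E₀(v ⊓ n) = E₀(v)`: every nonnegative ground state `Ψ₀` of `v`
is a.e. `> 0` on the box. With `Tₙ = e^{-H(v ⊓ n)}` on `L²(Λ)`, `‖Tₙ‖ = e^{-E₀(v⊓n)}` (Perron–Frobenius
vector + `norm_fkL2_one_eq_exp_neg_groundStateEnergy`) and Jensen give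
`‖TₙΨ₀ − e^{-E₀}Ψ₀‖² ≤ e^{-2E₀(v⊓n)} − e^{-2E₀} → 0`; if `A = {Ψ₀ ≤ 0} ∩ Λ` had positive measure,
symmetry gives `∫_Λ Ψ₀ · Tₙ1_A = ⟨1_A, TₙΨ₀⟩ → 0`, while at a point `X⋆ ∈ A` off the collision set
charged by `A` (`exists_mem_forall_mem_nhdsWithin_pos_measure`) a.e. `Y` has a collision-free segment
to `X⋆` (exceptional `Y`: some `yᵢ − yⱼ` on the line of `x⋆ᵢ − x⋆ⱼ`, null by a shear), so the tube
bound gives `Tₙ1_A(Y) ≥ c(Y) > 0` for all `n`, and Fatou forces `Ψ₀ = 0` a.e. on `Λ` — contradiction.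
Reed–Simon IV §XIII.12 Thm XIII.44; Faris–Simon, Duke Math. J. 42 (1975) (singular case).
-/

noncomputable section

open MeasureTheory Filter Set
open scoped ENNReal NNReal Topology InnerProductSpace

namespace Summit.AtomisticToContinuum.BoseEinsteinCondensation.Theorems.GroundStateRigidity

open Literature.MathematicalPhysics.QuantumManyBody.BoseGas

namespace PosOfTrunc

variable {N : ℕ}

/-! ### Null sets: pair differences in a null set, collisions, rays -/

/-- **Null pair-difference sets**: for `i ≠ j` and a measurable Lebesgue-null `S ⊂ ℝ³`, the set of
configurations with `xᵢ − xⱼ ∈ S` is Lebesgue-null in `(ℝ³)^N` (the shear `xᵢ ↦ xᵢ − xⱼ` has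
determinant `±1`, and a coordinate preimage of a null set is null). [folklore] -/
theorem volume_setOf_sub_mem_eq_zero {i j : Fin N} (hij : i ≠ j) {S : Set Space}
    (hS : MeasurableSet S) (h0 : volume S = 0) :
    volume {X : Config N | X i - X j ∈ S} = 0 := by
  have hB0 : volume (Function.eval i ⁻¹' S : Set (Config N)) = 0 := by
    rw [volume_pi]
    exact Measure.pi_eval_preimage_null _ h0
  have hset : {X : Config N | X i - X j ∈ S} = (shear hij) ⁻¹' (Function.eval i ⁻¹' S) := by
    ext X
    simp only [mem_setOf_eq, mem_preimage, Function.eval]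
    rw [show ((shear hij) X) i = X i - X j from shear_apply_self hij X]
  have hdet : LinearMap.det ((shear hij : Config N ≃ₗ[ℝ] Config N) : Config N →ₗ[ℝ] Config N) ≠ 0 :=
    (LinearEquiv.isUnit_det' (shear hij)).ne_zero
  have hmap := Measure.map_linearMap_addHaar_eq_smul_addHaar (μ := (volume : Measure (Config N))) hdet
  have hmeasB : MeasurableSet (Function.eval i ⁻¹' S : Set (Config N)) := measurable_pi_apply i hS
  have hmeasφ : Measurable
      ((shear hij : Config N ≃ₗ[ℝ] Config N) : Config N →ₗ[ℝ] Config N) :=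
    (LinearMap.continuous_of_finiteDimensional _).measurable
  have key : (Measure.map ((shear hij : Config N ≃ₗ[ℝ] Config N) : Config N →ₗ[ℝ] Config N) volume)
      (Function.eval i ⁻¹' S) = 0 := by
    rw [hmap, Measure.smul_apply, hB0, smul_zero]
  rw [Measure.map_apply hmeasφ hmeasB] at key
  rw [hset]
  simpa only [LinearEquiv.coe_coe] using key

/-- **The collision set is null**: `{X | ∃ i ≠ j, xᵢ = xⱼ}` has Lebesgue measure zero in `(ℝ³)^N`
(finite union of the null sets `{xᵢ − xⱼ ∈ {0}}`). [folklore] -/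
theorem volume_collision_eq_zero :
    volume {X : Config N | ∃ i j : Fin N, i ≠ j ∧ X i = X j} = 0 := by
  have hsub : {X : Config N | ∃ i j : Fin N, i ≠ j ∧ X i = X j} ⊆
      ⋃ i : Fin N, ⋃ j : Fin N, {X : Config N | i ≠ j ∧ X i - X j ∈ ({0} : Set Space)} := by
    intro X hX
    obtain ⟨i, j, hij, h⟩ := hX
    refine mem_iUnion.2 ⟨i, mem_iUnion.2 ⟨j, ⟨hij, ?_⟩⟩⟩
    simp [h]
  refine measure_mono_null hsub ((measure_iUnion_null_iff).2 fun i => ?_)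
  refine (measure_iUnion_null_iff).2 fun j => ?_
  by_cases hij : i = j
  · have : {X : Config N | i ≠ j ∧ X i - X j ∈ ({0} : Set Space)} = ∅ := by
      ext X; simp [hij]
    rw [this, measure_empty]
  · have hle : {X : Config N | i ≠ j ∧ X i - X j ∈ ({0} : Set Space)} ⊆
        {X : Config N | X i - X j ∈ ({0} : Set Space)} := fun X hX => hX.2
    exact measure_mono_null hle
      (volume_setOf_sub_mem_eq_zero hij (measurableSet_singleton 0) (measure_singleton 0))

/-- A line through the origin is a strict subspace of `ℝ³`. [folklore] -/
theorem span_singleton_ne_top (d : Space) : (Submodule.span ℝ ({d} : Set Space)) ≠ ⊤ := by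
  intro htop
  have h1 : Module.finrank ℝ (Submodule.span ℝ ({d} : Set Space)) ≤ 1 := by
    have h := finrank_span_le_card (R := ℝ) ({d} : Set Space)
    simpa using h
  have h3 : Module.finrank ℝ (Submodule.span ℝ ({d} : Set Space)) = 3 := by
    rw [htop, finrank_top, finrank_euclideanSpace, Fintype.card_fin]
  omega

/-- **The exceptional starting points are null**: for a fixed configuration `X⋆`, the set of `Y` with
some pair difference `yᵢ − yⱼ` (`i ≠ j`) on the line spanned by `x⋆ᵢ − x⋆ⱼ` is Lebesgue-null.
[folklore] -/
theorem volume_badSet_eq_zero (Xs : Config N) :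
    volume (⋃ i : Fin N, ⋃ j : Fin N, {Y : Config N | i ≠ j ∧
      Y i - Y j ∈ (Submodule.span ℝ ({Xs i - Xs j} : Set Space) : Set Space)}) = 0 := by
  refine (measure_iUnion_null_iff).2 fun i => (measure_iUnion_null_iff).2 fun j => ?_
  by_cases hij : i = j
  · have : {Y : Config N | i ≠ j ∧
        Y i - Y j ∈ (Submodule.span ℝ ({Xs i - Xs j} : Set Space) : Set Space)} = ∅ := by
      ext X; simp [hij]
    rw [this, measure_empty]
  · refine measure_mono_null (fun Y hY => hY.2) (volume_setOf_sub_mem_eq_zero hij ?_ ?_)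
    · exact (Submodule.closed_of_finiteDimensional _).measurableSet
    · exact Measure.addHaar_submodule volume _ (span_singleton_ne_top _)

/-- **Collision-free segments from good starting points**: if `X⋆` has no collision and no pair
difference of `Y` lies on the line spanned by the corresponding pair difference of `X⋆`, then the
straight segment `[Y, X⋆]` is collision-free. [folklore] -/
theorem segment_ne_zero {Y Xs : Config N} (hXs : ∀ i j : Fin N, i ≠ j → Xs i ≠ Xs j)
    (hY : Y ∉ ⋃ i : Fin N, ⋃ j : Fin N, {Y : Config N | i ≠ j ∧
      Y i - Y j ∈ (Submodule.span ℝ ({Xs i - Xs j} : Set Space) : Set Space)}) :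
    ∀ θ : ℝ, θ ∈ Set.Icc (0 : ℝ) 1 → ∀ i j : Fin N, i ≠ j →
      (1 - θ) • (Y i - Y j) + θ • (Xs i - Xs j) ≠ 0 := by
  intro θ _ i j hij h
  by_cases hθ : θ = 1
  · subst hθ
    simp only [sub_self, zero_smul, one_smul, zero_add, sub_eq_zero] at h
    exact hXs i j hij h
  · have h1 : (1 - θ) ≠ 0 := sub_ne_zero.2 (Ne.symm hθ)
    have hmem : Y i - Y j ∈ (Submodule.span ℝ ({Xs i - Xs j} : Set Space) : Set Space) := by
      have heq : Y i - Y j = (-(θ / (1 - θ))) • (Xs i - Xs j) := by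
        have h2 : (1 - θ) • (Y i - Y j) = -(θ • (Xs i - Xs j)) := eq_neg_of_add_eq_zero_left h
        calc Y i - Y j = (1 - θ)⁻¹ • ((1 - θ) • (Y i - Y j)) := by
              rw [smul_smul, inv_mul_cancel₀ h1, one_smul]
          _ = (-(θ / (1 - θ))) • (Xs i - Xs j) := by
              rw [h2, smul_neg, smul_smul, neg_smul, div_eq_inv_mul]
      rw [heq]
      exact Submodule.smul_mem _ _ (Submodule.subset_span rfl)
    exact hY (mem_iUnion.2 ⟨i, mem_iUnion.2 ⟨j, ⟨hij, hmem⟩⟩⟩)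

/-- Coordinate boxes `{Z | ∀ i k, |Z i k − X i k| < δ}` are open. [folklore] -/
theorem isOpen_coordBox (Xs : Config N) (δ : ℝ) :
    IsOpen {Z : Config N | ∀ i k, |Z i k - Xs i k| < δ} := by
  have h : {Z : Config N | ∀ i k, |Z i k - Xs i k| < δ} =
      ⋂ i : Fin N, ⋂ k : Fin 3, {Z : Config N | |Z i k - Xs i k| < δ} := by
    ext Z; simp
  rw [h]
  refine isOpen_iInter_of_finite fun i => isOpen_iInter_of_finite fun k => ?_
  have hc : Continuous fun Z : Config N => Z i k :=
    (PiLp.continuous_apply 2 (fun _ : Fin 3 => ℝ) k).comp (continuous_apply i)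
  exact isOpen_lt (continuous_abs.comp (hc.sub continuous_const)) continuous_const

/-! ### The approximate Perron–Frobenius vector -/

/-- **Approximate eigenvector estimate.** For a symmetric bounded operator `T` on a real Hilbert
space, a unit vector `ψ` with `⟪ψ, Tψ⟫ ≥ λ > 0` and `‖T‖ ≤ M` obeys `‖Tψ − λψ‖² ≤ M² − λ²`.
[folklore] -/
theorem norm_sub_smul_sq_le {H : Type*} [NormedAddCommGroup H] [InnerProductSpace ℝ H]
    (T : H →L[ℝ] H) {ψ : H} (hψ : ‖ψ‖ = 1) {lam M : ℝ} (hlam : 0 ≤ lam)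
    (hRay : lam ≤ ⟪ψ, T ψ⟫_ℝ) (hM : ‖T‖ ≤ M) :
    ‖T ψ - lam • ψ‖ ^ 2 ≤ M ^ 2 - lam ^ 2 := by
  have h1 : ‖T ψ‖ ≤ M := by
    calc ‖T ψ‖ ≤ ‖T‖ * ‖ψ‖ := T.le_opNorm ψ
      _ ≤ M * 1 := by rw [hψ]; exact mul_le_mul_of_nonneg_right hM zero_le_one
      _ = M := mul_one M
  rw [norm_sub_sq_real, real_inner_smul_right, real_inner_comm, norm_smul, Real.norm_eq_abs,
    abs_of_nonneg hlam, hψ, mul_one]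
  nlinarith [mul_le_mul_of_nonneg_left hRay hlam, pow_le_pow_left₀ (norm_nonneg _) h1 2]

end PosOfTrunc

/-! ### The stub -/

set_option maxHeartbeats 400000 in
open PosOfTrunc in
/-- **Stub `stub_posOfTrunc` of line `Sketch` (lead c2) — a.e. positivity of nonnegative ground
states for potentials locally bounded on `(0, ∞)`, from energy truncation** (statement and proof in the
module docstring: approximate Perron–Frobenius vector by Jensen + `‖e^{-H(v⊓n)}‖ = e^{-E₀(v⊓n)}`,
symmetry, `n`-uniform local tube bound at a charged collision-free point, Fatou).
[cite: ReedSimonIV1978, §XIII.12 Thm XIII.44] -/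
theorem stub_posOfTrunc :
    (∀ (N : ℕ) (v w : ℝ → ℝ≥0∞) (C : ℝ≥0) (L : ℝ), 1 ≤ N → 0 < L → Measurable v → Measurable w →
      (∀ r, w r ≤ C) → (∀ r, w r ≤ v r) →
      ∀ Ψ₀ : Config N → ℝ, (∀ X, 0 ≤ Ψ₀ X) → IsGroundState v L (fun X => (Ψ₀ X : ℂ)) →
        Real.exp (-(groundStateEnergy v N L).toReal) ≤
          ∫ X in boxN N L, Ψ₀ X * fkReal w L 1 Ψ₀ X) →
    (∀ (N : ℕ) (L : ℝ) (Y Xs : Config N), 0 < L → Y ∈ boxN N L → Xs ∈ boxN N L →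
      (∀ θ : ℝ, θ ∈ Set.Icc (0 : ℝ) 1 → ∀ i j : Fin N, i ≠ j →
        (1 - θ) • (Y i - Y j) + θ • (Xs i - Xs j) ≠ 0) →
      ∀ A : Set (Config N), MeasurableSet A →
      (∀ δ : ℝ, 0 < δ → 0 < volume (A ∩ {Z : Config N | ∀ i k, |Z i k - Xs i k| < δ})) →
      ∃ r : ℝ, 0 < r ∧ ∀ C : ℝ≥0, ∃ c : ℝ, 0 < c ∧ ∀ w : ℝ → ℝ≥0∞, Measurable w →
        (∀ s : ℝ, r ≤ s → w s ≤ C) → c ≤ fkReal w L 1 (A.indicator fun _ => (1 : ℝ)) Y) →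
    ∀ (N : ℕ) (v : ℝ → ℝ≥0∞) (L : ℝ), 1 ≤ N → 0 < L → Measurable v →
      (∀ r : ℝ, 0 < r → ∃ C : ℝ≥0, ∀ s : ℝ, r ≤ s → v s ≤ C) →
      (⨆ n : ℕ, groundStateEnergy (fun r => min (v r) (n : ℝ≥0∞)) N L = groundStateEnergy v N L) →
      ∀ Ψ₀ : Config N → ℝ, (∀ X, 0 ≤ Ψ₀ X) → IsGroundState v L (fun X => (Ψ₀ X : ℂ)) →
        ∀ᵐ X : Config N, X ∈ boxN N L → 0 < Ψ₀ X := by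
  intro hJ hT N v L hN hL hv hlb hsup Ψ₀ hΨ0 hΨ
  set w : ℕ → ℝ → ℝ≥0∞ := fun n r => min (v r) (n : ℝ≥0∞) with hwdef
  have hwm : ∀ n, Measurable (w n) := fun n => hv.min measurable_const
  have hwC : ∀ n : ℕ, ∀ r, w n r ≤ ((n : ℝ≥0) : ℝ≥0∞) := fun n r => by
    rw [ENNReal.coe_natCast]; exact min_le_right _ _
  have hwv : ∀ n, ∀ r, w n r ≤ v r := fun n r => min_le_left _ _
  set E : ℝ≥0∞ := groundStateEnergy v N L with hEdef
  have hE : E ≠ ⊤ := hΨ.groundStateEnergy_ne_top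
  set En : ℕ → ℝ≥0∞ := fun n => groundStateEnergy (w n) N L with hEndef
  have hmonoE : ∀ {u u' : ℝ → ℝ≥0∞}, (∀ r, u r ≤ u' r) →
      groundStateEnergy u N L ≤ groundStateEnergy u' N L := fun h =>
    iInf_mono fun Ψ => lintegral_mono fun X =>
      add_le_add le_rfl (mul_le_mul' (ClosedJensen.interaction_mono h X) le_rfl)
  have hEn_mono : Monotone En := by
    refine monotone_nat_of_le_succ fun n => hmonoE fun r => ?_
    exact min_le_min le_rfl (by exact_mod_cast Nat.le_succ n)
  have hEn_tend : Tendsto (fun n => (En n).toReal) atTop (𝓝 E.toReal) := by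
    have h1 : Tendsto En atTop (𝓝 (⨆ n, En n)) := tendsto_atTop_iSup hEn_mono
    rw [show (⨆ n, En n) = E from hsup] at h1
    exact (ENNReal.tendsto_toReal hE).comp h1
  set lam : ℝ := Real.exp (-E.toReal) with hlamdef
  have hlam0 : 0 < lam := Real.exp_pos _
  -- `Ψ₀`: measurable, zero off the box, normalised, in `L²(Λ)`
  have hΨm : Measurable Ψ₀ := by
    have h := Complex.measurable_re.comp hΨ.measurable
    have heq : (Complex.re ∘ fun X => (Ψ₀ X : ℂ)) = Ψ₀ := funext fun X => Complex.ofReal_re _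
    rwa [heq] at h
  have hΨz : ∀ X, X ∉ boxN N L → Ψ₀ X = 0 := fun X hX =>
    Complex.ofReal_eq_zero.1 (hΨ.eq_zero X hX)
  have hΨ1 : ∫⁻ X, ‖Ψ₀ X‖ₑ ^ 2 = 1 := by
    refine Eq.trans (lintegral_congr fun X => ?_) hΨ.norm_eq
    rw [enorm_eq_nnnorm, Complex.nnnorm_real]
  have hΨsq : ∫ X, Ψ₀ X ^ 2 = 1 := by
    rw [integral_eq_lintegral_of_nonneg_ae (Eventually.of_forall fun X => sq_nonneg _)
      (hΨm.pow_const 2).aestronglyMeasurable]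
    simp_rw [← enorm_sq_eq_ofReal_sq]
    rw [hΨ1, ENNReal.toReal_one]
  have hΨmem : MemLp Ψ₀ 2 (volume.restrict (boxN N L)) := by
    refine MemLp.restrict _ ⟨hΨm.aestronglyMeasurable, ?_⟩
    rw [eLpNorm_eq_lintegral_rpow_enorm_toReal two_ne_zero ENNReal.ofNat_ne_top,
      ENNReal.toReal_ofNat]
    simp_rw [ENNReal.rpow_two]
    rw [hΨ1, ENNReal.one_rpow]
    exact ENNReal.one_lt_top
  have hΨ2 : ∫⁻ Y in boxN N L, ‖Ψ₀ Y‖ₑ ^ (2 : ℝ) ≠ ⊤ := by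
    refine ne_top_of_le_ne_top ENNReal.one_ne_top ?_
    rw [← hΨ1]
    simp_rw [ENNReal.rpow_two]
    exact setLIntegral_le_lintegral _ _
  set ψL : Lp ℝ 2 (volume.restrict (boxN N L)) := hΨmem.toLp Ψ₀ with hψLdef
  have hψL1 : ‖ψL‖ = 1 := by
    have h : ‖ψL‖ ^ 2 = 1 := by
      rw [hψLdef, ClosedJensen.norm_toLp_sq, setIntegral_eq_integral_of_forall_compl_eq_zero
        (fun X hX => by simp [hΨz X hX]), hΨsq]
    nlinarith [norm_nonneg ψL]
  have hA : ∀ n : ℕ, ‖fkL2 (w n) L 1 ψL - lam • ψL‖ ^ 2 ≤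
      Real.exp (-(En n).toReal) ^ 2 - lam ^ 2 := by
    intro n
    obtain ⟨-, e, -, -, hTe, hepos, -⟩ := fkL2_perronFrobenius (N := N) (hwm n) (hwC n) hL one_pos
    have hnorm : ‖fkL2 (N := N) (w n) L 1‖ = Real.exp (-(En n).toReal) :=
      norm_fkL2_one_eq_exp_neg_groundStateEnergy hN (hwm n) (hwC n) hL hTe hepos
    have hRay : lam ≤ ⟪ψL, fkL2 (w n) L 1 ψL⟫_ℝ := by
      rw [hψLdef, ClosedJensen.inner_toLp_fkL2_toLp (hwm n) L one_pos hΨmem]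
      exact hJ N v (w n) (n : ℝ≥0) L hN hL hv (hwm n) (hwC n) (hwv n) Ψ₀ hΨ0 hΨ
    exact norm_sub_smul_sq_le (fkL2 (w n) L 1) hψL1 hlam0.le hRay hnorm.le
  have hA_tend : Tendsto (fun n : ℕ => Real.exp (-(En n).toReal) ^ 2 - lam ^ 2) atTop (𝓝 0) := by
    have h : Tendsto (fun n : ℕ => Real.exp (-(En n).toReal) ^ 2 - lam ^ 2) atTop
        (𝓝 (Real.exp (-E.toReal) ^ 2 - lam ^ 2)) :=
      ((Real.continuous_exp.tendsto _).comp hEn_tend.neg).pow 2 |>.sub tendsto_const_nhds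
    rwa [hlamdef, sub_self] at h
  -- suppose the zero set `A` of `Ψ₀` in the box has positive measure
  rw [ae_iff]
  by_contra hAne
  set A : Set (Config N) := {X | X ∈ boxN N L ∧ Ψ₀ X ≤ 0} with hAdef
  have hAeq : {X : Config N | ¬(X ∈ boxN N L → 0 < Ψ₀ X)} = A := by
    ext X; simp [hAdef, not_lt]
  rw [hAeq] at hAne
  have hAm : MeasurableSet A := (measurableSet_boxN N L).inter (measurableSet_le hΨm measurable_const)
  have hAbox : A ⊆ boxN N L := fun X hX => hX.1
  have hΨA : ∀ X ∈ A, Ψ₀ X = 0 := fun X hX => le_antisymm hX.2 (hΨ0 X)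
  set g : Config N → ℝ := A.indicator fun _ => (1 : ℝ) with hgdef
  have hgm : Measurable g := measurable_const.indicator hAm
  have hg0 : ∀ X, 0 ≤ g X := fun X => Set.indicator_nonneg (fun _ _ => zero_le_one) X
  have hg1 : ∀ X, g X ≤ 1 := fun X => Set.indicator_le_self' (fun _ _ => zero_le_one) X
  have hgabs : ∀ X, ‖g X‖ ≤ 1 := fun X => by
    rw [Real.norm_eq_abs, abs_of_nonneg (hg0 X)]; exact hg1 X
  haveI : IsFiniteMeasure (volume.restrict (boxN N L)) :=
    isFiniteMeasure_restrict.2 (volume_boxN_lt_top N L).ne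
  have hgmem : MemLp g 2 (volume.restrict (boxN N L)) :=
    MemLp.of_bound hgm.aestronglyMeasurable 1 (Eventually.of_forall hgabs)
  have hg2 : ∫⁻ Y in boxN N L, ‖g Y‖ₑ ^ (2 : ℝ) ≠ ⊤ := by
    refine ne_top_of_le_ne_top (volume_boxN_lt_top N L).ne ?_
    calc ∫⁻ Y in boxN N L, ‖g Y‖ₑ ^ (2 : ℝ) ≤ ∫⁻ _Y in boxN N L, 1 := by
          refine lintegral_mono fun Y => ?_
          rw [ENNReal.rpow_two, Real.enorm_of_nonneg (hg0 Y)]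
          exact pow_le_one' (ENNReal.ofReal_le_one.2 (hg1 Y)) 2
      _ = volume (boxN N L) := by rw [setLIntegral_const, one_mul]
  set gL : Lp ℝ 2 (volume.restrict (boxN N L)) := hgmem.toLp g with hgLdef
  set I : ℕ → ℝ := fun n => ∫ X in boxN N L, Ψ₀ X * fkReal (w n) L 1 g X with hIdef
  have hI_inner : ∀ n, I n = ⟪gL, fkL2 (w n) L 1 ψL - lam • ψL⟫_ℝ := by
    intro n
    have h1 : ⟪gL, fkL2 (w n) L 1 ψL⟫_ℝ = ∫ X in boxN N L, g X * fkReal (w n) L 1 Ψ₀ X := by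
      rw [L2.inner_def]
      refine integral_congr_ae ?_
      filter_upwards [hgmem.coeFn_toLp, fkL2_coeFn (hwm n) L one_pos ψL] with X h1 h2
      rw [RCLike.inner_apply, conj_trivial, h2, hgLdef, h1, hψLdef,
        fkReal_congr_ae_restrict (w n) L one_pos hΨmem.coeFn_toLp X, mul_comm]
    have h2 : ⟪gL, ψL⟫_ℝ = 0 := by
      rw [L2.inner_def]
      refine integral_eq_zero_of_ae ?_
      filter_upwards [hgmem.coeFn_toLp, hΨmem.coeFn_toLp] with X h1 h2
      rw [RCLike.inner_apply, conj_trivial, hgLdef, h1, hψLdef, h2, Pi.zero_apply]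
      by_cases hX : X ∈ A
      · rw [hΨA X hX, zero_mul]
      · rw [hgdef, Set.indicator_of_notMem hX, mul_zero]
    rw [inner_sub_right, real_inner_smul_right, h2, mul_zero, sub_zero, h1, hIdef]
    exact (setIntegral_mul_fkReal_comm (hwm n) L one_pos hΨm hgm hΨ2 hg2).symm
  have hI_nonneg : ∀ n, 0 ≤ I n := fun n =>
    setIntegral_nonneg (measurableSet_boxN N L) fun X _ =>
      mul_nonneg (hΨ0 X) (fkReal_nonneg (w n) L 1 hg0 X)
  have hI_tend : Tendsto I atTop (𝓝 0) := by
    have hb : ∀ n, |I n| ≤ ‖gL‖ * Real.sqrt (Real.exp (-(En n).toReal) ^ 2 - lam ^ 2) := by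
      intro n
      rw [hI_inner n]
      refine (abs_real_inner_le_norm _ _).trans (mul_le_mul_of_nonneg_left ?_ (norm_nonneg _))
      rw [← Real.sqrt_sq (norm_nonneg (fkL2 (w n) L 1 ψL - lam • ψL))]
      exact Real.sqrt_le_sqrt (hA n)
    have h0 : Tendsto (fun n => ‖gL‖ * Real.sqrt (Real.exp (-(En n).toReal) ^ 2 - lam ^ 2)) atTop
        (𝓝 0) := by
      have h := (Real.continuous_sqrt.tendsto _).comp hA_tend
      rw [Function.comp_def, Real.sqrt_zero] at h
      simpa using h.const_mul ‖gL‖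
    exact squeeze_zero_norm (fun n => by rw [Real.norm_eq_abs]; exact hb n) h0
  -- Step C: a point of `A` off the collision set, charged by `A` in every coordinate box
  set Δ : Set (Config N) := {X | ∃ i j : Fin N, i ≠ j ∧ X i = X j} with hΔdef
  have hΔ0 : volume Δ = 0 := volume_collision_eq_zero
  have hs0 : volume (A \ Δ) ≠ 0 := by rwa [measure_sdiff_null hΔ0]
  obtain ⟨Xs, hXs, hXcharge⟩ := exists_mem_forall_mem_nhdsWithin_pos_measure hs0
  have hXsbox : Xs ∈ boxN N L := hAbox hXs.1
  have hXsΔ : ∀ i j : Fin N, i ≠ j → Xs i ≠ Xs j := fun i j hij h => hXs.2 ⟨i, j, hij, h⟩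
  have hAcharge : ∀ δ : ℝ, 0 < δ → 0 < volume (A ∩ {Z : Config N | ∀ i k, |Z i k - Xs i k| < δ}) := by
    intro δ hδ
    set U : Set (Config N) := {Z | ∀ i k, |Z i k - Xs i k| < δ} with hUdef
    have hU : U ∈ 𝓝 Xs := (isOpen_coordBox Xs δ).mem_nhds (by simp [hδ])
    have h := hXcharge ((A \ Δ) ∩ U) (inter_mem_nhdsWithin _ hU)
    exact h.trans_le (measure_mono fun Z hZ => ⟨hZ.1.1, hZ.2⟩)
  set B : Set (Config N) := ⋃ i : Fin N, ⋃ j : Fin N, {Y : Config N | i ≠ j ∧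
      Y i - Y j ∈ (Submodule.span ℝ ({Xs i - Xs j} : Set Space) : Set Space)} with hBdef
  have hB0 : volume B = 0 := volume_badSet_eq_zero Xs
  have hgood : ∀ Y, Y ∈ boxN N L → Y ∉ B → ∃ c : ℝ, 0 < c ∧ ∀ n, c ≤ fkReal (w n) L 1 g Y := by
    intro Y hY hYB
    obtain ⟨r, hr, H⟩ := hT N L Y Xs hL hY hXsbox (segment_ne_zero hXsΔ hYB) A hAm hAcharge
    obtain ⟨C, hC⟩ := hlb r hr
    obtain ⟨c, hc, Hc⟩ := H C
    exact ⟨c, hc, fun n => Hc (w n) (hwm n) fun s hs => (hwv n s).trans (hC s hs)⟩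
  -- Fatou: `∫_Λ Ψ₀ · liminf Tₙ g ≤ liminf Iₙ = 0`
  set G : ℕ → Config N → ℝ≥0∞ := fun n Y => ENNReal.ofReal (Ψ₀ Y * fkReal (w n) L 1 g Y) with hGdef
  have hGm : ∀ n, Measurable (G n) := fun n =>
    (hΨm.mul (measurable_fkReal (hwm n) L 1 hgm)).ennreal_ofReal
  have hJ_eq : ∀ n, ∫⁻ Y in boxN N L, G n Y = ENNReal.ofReal (I n) := by
    intro n
    rw [hIdef]
    rw [ofReal_integral_eq_lintegral_ofReal (integrable_mul_fkReal (hwm n) L zero_le_one hgm hΨm hg2 hΨ2)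
      (Eventually.of_forall fun X => mul_nonneg (hΨ0 X) (fkReal_nonneg (w n) L 1 hg0 X))]
  have hJ_tend : Tendsto (fun n => ∫⁻ Y in boxN N L, G n Y) atTop (𝓝 0) := by
    simp_rw [hJ_eq]
    rw [← ENNReal.ofReal_zero]
    exact ENNReal.tendsto_ofReal hI_tend
  have hFatou : ∫⁻ Y in boxN N L, liminf (fun n => G n Y) atTop = 0 := by
    refine le_antisymm ?_ bot_le
    calc ∫⁻ Y in boxN N L, liminf (fun n => G n Y) atTop
        ≤ liminf (fun n => ∫⁻ Y in boxN N L, G n Y) atTop :=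
          lintegral_liminf_le' fun n => (hGm n).aemeasurable
      _ = 0 := hJ_tend.liminf_eq
  have hlim0 : ∀ᵐ Y ∂volume.restrict (boxN N L), liminf (fun n => G n Y) atTop = 0 :=
    (lintegral_eq_zero_iff' (Measurable.liminf hGm).aemeasurable).1 hFatou
  have hB' : ∀ᵐ Y ∂volume.restrict (boxN N L), Y ∉ B :=
    ae_restrict_of_ae (measure_eq_zero_iff_ae_notMem.1 hB0)
  have hzero : ∀ᵐ Y ∂volume.restrict (boxN N L), Ψ₀ Y = 0 := by
    filter_upwards [hlim0, hB', ae_restrict_mem (measurableSet_boxN N L)] with Y h1 h2 h3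
    obtain ⟨c, hc, hcn⟩ := hgood Y h3 h2
    have hle : ENNReal.ofReal (Ψ₀ Y * c) ≤ liminf (fun n => G n Y) atTop := by
      refine le_liminf_of_le (by isBoundedDefault) (Eventually.of_forall fun n => ?_)
      exact ENNReal.ofReal_le_ofReal (mul_le_mul_of_nonneg_left (hcn n) (hΨ0 Y))
    rw [h1, nonpos_iff_eq_zero, ENNReal.ofReal_eq_zero] at hle
    have : Ψ₀ Y ≤ 0 := by
      by_contra hpos
      exact absurd hle (not_le.2 (mul_pos (not_le.1 hpos) hc))
    exact le_antisymm this (hΨ0 Y)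
  have hint0 : ∫⁻ X, ‖Ψ₀ X‖ₑ ^ 2 = 0 := by
    have hsupp : ∫⁻ X, ‖Ψ₀ X‖ₑ ^ 2 = ∫⁻ X in boxN N L, ‖Ψ₀ X‖ₑ ^ 2 := by
      refine (setLIntegral_eq_of_support_subset fun X hX => ?_).symm
      by_contra hXb
      exact hX (by simp [hΨz X hXb])
    rw [hsupp]
    refine (lintegral_eq_zero_iff' (hΨm.enorm.pow_const 2).aemeasurable).2 ?_
    filter_upwards [hzero] with Y hY
    simp [hY]
  rw [hint0] at hΨ1
  exact zero_ne_one hΨ1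

end Summit.AtomisticToContinuum.BoseEinsteinCondensation.Theorems.GroundStateRigidity

end
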